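import Literature.MathematicalPhysics.QuantumFieldTheory.Balaban1983to89.Beta.GradedBubbles

/-!
# Road FP (binder row D1), row H′2-IR ∕ IR-1, GENERIC HALF: A SCALE-`ρ` BLOCK WEIGHT AGAINST A SUB-MARGINAL GRADED KERNEL ON `ℤ⁴`
# — PART 1: SHELL SUMS, NEAR ∕ FAR FIELD, THE PROFILE, DIFFERENCES (our bookkeeping; no object of Bałaban's enters)

HONEST DEPENDENCY (page 1, mandatory): continuum YM on T⁴ ⇐ BetaPertH ∧ nine spine estimates (0/9 proved); BetaPertH ⇐ (D1) ∧ (D4) ∧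
CAP+tail; G-an2-4 gates asym, D1 and NE2/3/4.  HONEST FRAMING (cell contract, verbatim): «discharging `BetaPertH` makes Bałaban's UV
stability UNCONDITIONAL — a real constructive-QFT result; it is NOT the continuum limit and NOT the Clay problem.»  THIS MODULE is
elementary real analysis on finite sums over `ℤ⁴` (our bookkeeping, not in print and not claimed to be): it cites nothing, mints no
`def … : Prop`, declares no data `def`, has 0 `sorry`.  It discharges NOTHING of row H′2-IR, of `hasym`, of D1 or of `BetaPertH`; it is
NOT (CONV-C), NOT D1, NOT the continuum limit, NOT Clay.

ABSOLUTE RULE (cell charter, verbatim): «No internally-minted statement may enter as a cited fact. Every hypothesis is either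
kernel-proved in this package or a verbatim quotation of a PUBLISHED theorem with page reference. The manuscript(s) under audit are NOT
citable for their own disputed steps — they are the thing under adjudication; programme-internal (2001/route/tribunal) claims are never
citable.»  Nothing is cited below; every analytic input is a displayed hypothesis.

THE ROW (owner d1-p3-g5, `OWNER-RULINGS-FP-5.md` R-FP-18 (c), `LEAVES-FP.md` H′2-IR ∕ IR-1): «block sums of `P^{BF}` against Bałaban's
contour averages: `|(P Q_nᵀ)(x,u)| ≤ C n^{3−d}(1 + dist(x, block u)∕n)^{2−d}`, x-differences one power of n better (d = 4 on the road)».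
Its INSTANCE (`FP/BlockAveragedPropagator.lean`) waits for the kernel letters of `P^{BF}` (row H2-P-KER-ASM, owner).  THIS FILE is the
GENERIC HALF the instance calls: the weight is ANY real profile `w` read on the sup-box `box 4 ρ` of offsets (mass `Σ_{s ∈ box ρ}|w s| ≤ W₁`,
flatness `|w s| ≤ W∞`), the kernel ANY `K : ℤ⁴ → ℝ` with `|K z| ≤ A∕(‖z‖∞+1)^a`, and the object is the block sum
`Σ_{s ∈ box 4 ρ} w s·K(p − s)` at the position `p` relative to the block centre.  DICTIONARY (not asserted about any object of the
series): for Bałaban's contour-block averaging column at `U = 1` one has `ρ ≍ n`, `W₁ ≍ n` (`n^{−d}` × `n^d` sites × a length-`n`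
contour) and `W∞(ρ+1)⁴ ≍ n`; with `a = d − 2 = 2` the PROFILE below reads `C·n∕(n + r)² = C·n^{3−d}(1 + r∕n)^{2−d}` — the row's shape —
and «x-differences one power better» is the same PROFILE for the difference kernel `Δ_i K` of degree `a + 1 = 3`.

CONTENT (all on `Pt = ℤ⁴` with the tree's `supNorm`, `box 4 R`, `annulus`; `a : ℕ`).
* §1 SHELL SUMS: `sum_box_eq_add_sum_annulus`; **`sum_box_inv_pow_succ_le`**: `a ≤ 3 ⟹ Σ_{z ∈ box 4 M} (‖z‖∞+1)^{−a} ≤ 81·(M+1)^{4−a}`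
  (`TransferUV.card_annulus_succ_four_le` `#shell ≤ 80(r+1)³` + `sum_annulus_zero_eq_sum_shells`); `abs_le_inv_pow_succ_of_isO` (the bridge
  from the `|f| ≤ A ∧ |f w| ≤ A∕‖w‖∞^a` shape of `GradedBubbles.IsO` to the `(‖w‖∞+1)`-shape used here, constant `2^a·A`).
* §2 GEOMETRY of the sup-norm: triangle inequalities in `ℕ`, `sum_box_comp_neg` (the box is symmetric), the translated box lands in `box (3ρ)`.
* §3 NEAR `abs_blockSum_le_near_sum` (any degree: `‖p‖∞ ≤ 2ρ ⟹ |Σ_s w s K(p−s)| ≤ W∞·A·Σ_{t∈box(3ρ)}(‖t‖∞+1)^{−a}`), `abs_blockSum_le_near`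
  (`a ≤ 3`: `≤ W∞·A·(81·(3ρ+1)^{4−a})`).
* §4 FAR `abs_blockSum_le_far`: `2ρ < ‖p‖∞ ⟹ |Σ_s w s K(p−s)| ≤ W₁·(2^a·A∕(‖p‖∞+1)^a)` (ANY `a`: every `‖p − s‖∞ + 1 ≥ (‖p‖∞+1)∕2`).
* §5 **PROFILE** `abs_blockSum_le_profile` (`a ≤ 3`, every `p`):
  `|Σ_{s ∈ box ρ} w s·K(p−s)| ≤ 3^a·(6561·W∞·(ρ+1)⁴ + W₁)·A ∕ (ρ + 1 + ‖p‖∞)^a`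
  — «a flat weight of mass `W₁` spread at scale `ρ` looks, to a kernel of degree `−a`, `a < d = 4`, like a point mass `W₁` kept at distance
  `≥ ρ`».  Plain averages (`W₁ = 1`, `W∞(ρ+1)⁴ ≤ 1`): constant `3^a·6562·A`.
* §6 DIFFERENCES `blockSum_shift_sub`, **`abs_blockSum_fwdDiff_le_profile`**: the `p`-difference of the block sum is the block sum of `Δ_i K`
  (degree `a+1 ≤ 3`) — one power better.
COMPANION FILE `FP/BlockAveragedKernelDipole.lean` (same seat): the DIPOLE gain for mean-zero weights (`Σ_s w s = 0` ⟹ one power of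
`(ρ+1)∕(ρ+1+‖p‖∞)` better, by coordinate-path telescoping inside the block, `LatticeTaylorPath.abs_taylor0D_le`), the DOUBLE AVERAGE (iterate §5;
the `Q_n P Q_nᵀ` shape) and the MARGINAL degree `a = 4` (near field logarithmic, `TransferUV.abs_sum_le_of_quartic`).
INSTANCES (same seat, separate files): `FP/BlockAveragedKernelAxial.lean` (the owner's IR-1-ABS (i)(ii)(iii) at the tree's block-and-contour
average `AxialComposition.axialAvg` ∕ `covAvg`), `FP/BlockAveragedKernelScalar.lean` (an2's plain `AffineAveraging.blockSum`, the `Q′` side),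
`FP/BlockAveragedKernelLegs.lean` (every `TwoPowerLegs.TwoPower` leg carries the letters; the free leg `latticeGreen∕2` unconditionally).
NOT HERE: any `P^{BF}`, `Q_n`, `G_C`, Woodbury remainder or n-uniformity statement of row H′2-IR (owner), anything printed.
Unit `b2b-balaban-gan24-formalise-leaf-04` (gen 39, idle G-an2-4 swarm leaf seat, cross-lane), 2026-08-20; `LEAVES-FP.md` sub-row IR-1-GEN; journal INTENT l.20663.
-/

noncomputable section

namespace Summit.QuantumFields.BalabanUV.Beta.FP.BlockAveragedKernel

open Finset
open scoped BigOperators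
open Literature.Probability.LatticeModels (box mem_box box_mono zero_mem_box annulus mem_annulus)
open Literature.MathematicalPhysics.QuantumFieldTheory.Balaban1983to89.Beta.DyadicShell
  (Pt supNorm natAbs_le_supNorm supNorm_le_iff natAbs_le_iff_mem mem_box_iff not_mem_box_iff mem_annulus_iff supNorm_eq_of_mem_sphere
   supNorm_eq_zero_iff supNorm_pos)
open Literature.MathematicalPhysics.QuantumFieldTheory.Balaban1983to89.Beta.TransferUV
  (card_annulus_succ_four_le sum_annulus_zero_eq_sum_shells)
open Literature.MathematicalPhysics.QuantumFieldTheory.Balaban1983to89.Beta.GradedBubbles (supNorm_neg)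

/-! ## §1 Shell sums of sub-marginal degree in `d = 4` -/

/-- [our bookkeeping] `box 4 0 = {0}`. -/
theorem box_four_zero : box 4 0 = {(0 : Pt)} := by
  ext z
  rw [mem_box_iff, Finset.mem_singleton, Nat.le_zero, supNorm_eq_zero_iff]

/-- [our bookkeeping] A sum over `box 4 M` is the centre term plus the sum over the punctured box `annulus 4 0 M`. -/
theorem sum_box_eq_add_sum_annulus (f : Pt → ℝ) (M : ℕ) :
    ∑ z ∈ box 4 M, f z = f 0 + ∑ z ∈ annulus 4 0 M, f z := by
  rw [annulus, box_four_zero, Finset.sdiff_singleton_eq_erase, Finset.add_sum_erase _ _ (zero_mem_box 4 M)]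

/-- **SUB-MARGINAL SHELL SUM.**  For `a ≤ 3` (one to three powers LESS than the dimension `4`):
`Σ_{z ∈ box 4 M} (‖z‖∞ + 1)^{−a} ≤ 81·(M+1)^{4−a}` — `#shell(r+1) ≤ 80(r+1)³` against `(r+2)^{−a} ≤ (r+1)^{−a}`, `M` shells, plus the centre.
[our bookkeeping] -/
theorem sum_box_inv_pow_succ_le {a : ℕ} (ha : a ≤ 3) (M : ℕ) :
    ∑ z ∈ box 4 M, 1 / ((supNorm z : ℝ) + 1) ^ a ≤ 81 * ((M : ℝ) + 1) ^ (4 - a) := by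
  rw [sum_box_eq_add_sum_annulus, sum_annulus_zero_eq_sum_shells]
  have h0 : supNorm (0 : Pt) = 0 := supNorm_eq_zero_iff.mpr rfl
  rw [h0, Nat.cast_zero, zero_add, one_pow, div_one]
  have hM1 : (1 : ℝ) ≤ ((M : ℝ) + 1) ^ (4 - a) := one_le_pow₀ (by linarith [(Nat.cast_nonneg M : (0 : ℝ) ≤ M)])
  -- each shell contributes at most `80·M^{3−a}`
  have hshell : ∀ r ∈ range M, ∑ z ∈ annulus 4 r (r + 1), 1 / ((supNorm z : ℝ) + 1) ^ a ≤ 80 * (M : ℝ) ^ (3 - a) := by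
    intro r hr
    have hrM : r + 1 ≤ M := mem_range.mp hr
    have hterm : ∀ z ∈ annulus 4 r (r + 1), 1 / ((supNorm z : ℝ) + 1) ^ a ≤ 1 / ((r : ℝ) + 1) ^ a := by
      intro z hz
      rw [supNorm_eq_of_mem_sphere hz]
      push_cast
      exact one_div_le_one_div_of_le (by positivity) (pow_le_pow_left₀ (by positivity) (by linarith) a)
    calc ∑ z ∈ annulus 4 r (r + 1), 1 / ((supNorm z : ℝ) + 1) ^ a
        ≤ ∑ _z ∈ annulus 4 r (r + 1), 1 / ((r : ℝ) + 1) ^ a := sum_le_sum hterm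
      _ = ((annulus 4 r (r + 1)).card : ℝ) * (1 / ((r : ℝ) + 1) ^ a) := by rw [sum_const, nsmul_eq_mul]
      _ ≤ 80 * ((r : ℝ) + 1) ^ 3 * (1 / ((r : ℝ) + 1) ^ a) :=
          mul_le_mul_of_nonneg_right (card_annulus_succ_four_le r) (by positivity)
      _ = 80 * ((r : ℝ) + 1) ^ (3 - a) := by
          have hr1 : (0 : ℝ) < (r : ℝ) + 1 := by positivity
          have e : ((r : ℝ) + 1) ^ 3 = ((r : ℝ) + 1) ^ (3 - a) * ((r : ℝ) + 1) ^ a := by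
            rw [← pow_add, Nat.sub_add_cancel ha]
          rw [e]; field_simp
      _ ≤ 80 * (M : ℝ) ^ (3 - a) := by
          have : (r : ℝ) + 1 ≤ M := by exact_mod_cast hrM
          gcongr
  have hsum : ∑ r ∈ range M, ∑ z ∈ annulus 4 r (r + 1), 1 / ((supNorm z : ℝ) + 1) ^ a ≤ 80 * (M : ℝ) ^ (4 - a) := by
    calc ∑ r ∈ range M, ∑ z ∈ annulus 4 r (r + 1), 1 / ((supNorm z : ℝ) + 1) ^ a
        ≤ ∑ _r ∈ range M, 80 * (M : ℝ) ^ (3 - a) := sum_le_sum hshell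
      _ = (M : ℝ) * (80 * (M : ℝ) ^ (3 - a)) := by rw [sum_const, card_range, nsmul_eq_mul]
      _ = 80 * (M : ℝ) ^ (4 - a) := by
          have e : 4 - a = (3 - a) + 1 := by omega
          rw [e, pow_succ]; ring
  have hpow : (M : ℝ) ^ (4 - a) ≤ ((M : ℝ) + 1) ^ (4 - a) :=
    pow_le_pow_left₀ (Nat.cast_nonneg M) (by linarith) _
  linarith

/-- **BRIDGE FROM THE `IsO`-SHAPE.**  A function bounded by `A` everywhere and by `A∕‖w‖∞^a` off the origin is bounded by
`2^a·A∕(‖w‖∞+1)^a` everywhere (`‖w‖∞ + 1 ≤ 2‖w‖∞` for `w ≠ 0`) — the letter shape used below. [our bookkeeping] -/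
theorem abs_le_inv_pow_succ_of_isO {f : Pt → ℝ} {A : ℝ} {a : ℕ} (h0 : ∀ w, |f w| ≤ A)
    (h1 : ∀ w, w ≠ 0 → |f w| ≤ A / (supNorm w : ℝ) ^ a) (w : Pt) :
    |f w| ≤ 2 ^ a * A / ((supNorm w : ℝ) + 1) ^ a := by
  have hA : 0 ≤ A := (abs_nonneg _).trans (h0 0)
  by_cases hw : w = 0
  · subst hw
    have h00 : supNorm (0 : Pt) = 0 := supNorm_eq_zero_iff.mpr rfl
    rw [h00, Nat.cast_zero, zero_add, one_pow, div_one]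
    exact (h0 0).trans (le_mul_of_one_le_left hA (one_le_pow₀ (by norm_num)))
  · have hone : (1 : ℝ) ≤ supNorm w := by
      exact_mod_cast Nat.one_le_iff_ne_zero.mpr fun h => hw (supNorm_eq_zero_iff.mp h)
    have hpos : (0 : ℝ) < supNorm w := by linarith
    refine (h1 w hw).trans ?_
    rw [div_le_div_iff₀ (by positivity) (by positivity)]
    calc A * ((supNorm w : ℝ) + 1) ^ a ≤ A * (2 * (supNorm w : ℝ)) ^ a :=
          mul_le_mul_of_nonneg_left (pow_le_pow_left₀ (by positivity) (by linarith) a) hA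
      _ = 2 ^ a * A * (supNorm w : ℝ) ^ a := by rw [mul_pow]; ring

/-! ## §2 Sup-norm geometry on `ℤ⁴` -/

/-- [our bookkeeping] `‖a + b‖∞ ≤ ‖a‖∞ + ‖b‖∞` in `ℕ`. -/
theorem supNorm_add_le_nat (a b : Pt) : supNorm (a + b) ≤ supNorm a + supNorm b :=
  supNorm_le_iff.mpr fun i =>
    (Int.natAbs_add_le (a i) (b i)).trans (Nat.add_le_add (natAbs_le_supNorm a i) (natAbs_le_supNorm b i))

/-- [our bookkeeping] `‖p‖∞ ≤ ‖p − s‖∞ + ‖s‖∞` in `ℕ`. -/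
theorem supNorm_le_supNorm_sub_add (p s : Pt) : supNorm p ≤ supNorm (p - s) + supNorm s := by
  simpa using supNorm_add_le_nat (p - s) s

/-- [our bookkeeping] `‖p − s‖∞ ≤ ‖p‖∞ + ‖s‖∞` in `ℕ`. -/
theorem supNorm_sub_le_nat (p s : Pt) : supNorm (p - s) ≤ supNorm p + supNorm s := by
  simpa [sub_eq_add_neg, supNorm_neg] using supNorm_add_le_nat p (-s)

/-- [our bookkeeping] The box is symmetric: `−s ∈ box 4 ρ ↔ s ∈ box 4 ρ`. -/
theorem neg_mem_box_iff {ρ : ℕ} {s : Pt} : -s ∈ box 4 ρ ↔ s ∈ box 4 ρ := by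
  rw [mem_box_iff, mem_box_iff, supNorm_neg]

/-- [our bookkeeping] Re-indexing a box sum by `s ↦ −s`. -/
theorem sum_box_comp_neg (f : Pt → ℝ) (ρ : ℕ) : ∑ s ∈ box 4 ρ, f (-s) = ∑ s ∈ box 4 ρ, f s :=
  Finset.sum_equiv (Equiv.neg Pt) (fun s => by rw [Equiv.neg_apply]; exact neg_mem_box_iff.symm)
    (fun s _ => by rw [Equiv.neg_apply])

/-- [our bookkeeping] Coordinates of a box point: `|s i| ≤ ρ`. -/
theorem abs_apply_le_of_mem_box {ρ : ℕ} {s : Pt} (hs : s ∈ box 4 ρ) (i : Fin 4) : |s i| ≤ (ρ : ℤ) := by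
  have h := (mem_box.mp hs) i
  exact abs_le.mpr ⟨h.1, h.2⟩

/-- [our bookkeeping] The mass of a weight profile is nonnegative, hence so is any mass letter `W₁`. -/
theorem mass_nonneg_of_le {w : Pt → ℝ} {ρ : ℕ} {W₁ : ℝ} (hW1 : ∑ s ∈ box 4 ρ, |w s| ≤ W₁) : 0 ≤ W₁ :=
  (sum_nonneg fun _ _ => abs_nonneg _).trans hW1

/-- [our bookkeeping] A flatness letter `W∞` is nonnegative (the box contains `0`). -/
theorem flat_nonneg_of_le {w : Pt → ℝ} {ρ : ℕ} {Winf : ℝ} (hWinf : ∀ s ∈ box 4 ρ, |w s| ≤ Winf) : 0 ≤ Winf :=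
  (abs_nonneg _).trans (hWinf 0 (zero_mem_box 4 ρ))

/-- [our bookkeeping] A kernel letter `A` in `|K z| ≤ A∕(‖z‖∞+1)^a` is nonnegative (read it at `z = 0`). -/
theorem letter_nonneg_of_le {K : Pt → ℝ} {A : ℝ} {a : ℕ} (hK : ∀ z, |K z| ≤ A / ((supNorm z : ℝ) + 1) ^ a) : 0 ≤ A := by
  have h := hK 0
  have h00 : supNorm (0 : Pt) = 0 := supNorm_eq_zero_iff.mpr rfl
  rw [h00, Nat.cast_zero, zero_add, one_pow, div_one] at h
  exact (abs_nonneg _).trans h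

/-! ## §3 NEAR FIELD: the flatness letter against the shell sum -/

/-- **THE NEAR-FIELD MECHANISM, degree-free.**  For `‖p‖∞ ≤ 2ρ` the translated box `p − box ρ` lies in `box (3ρ)`, so flatness
`|w| ≤ W∞` and the kernel letter bound the block sum by `W∞·A·Σ_{t ∈ box (3ρ)} (‖t‖∞+1)^{−a}` — for ANY degree `a`; the shell sum is then
read from §1 (`a ≤ 3`) or, in the marginal degree `a = 4`, from `TransferUV.abs_sum_le_of_quartic` (companion file). [our bookkeeping] -/
theorem abs_blockSum_le_near_sum {w K : Pt → ℝ} {ρ a : ℕ} {A Winf : ℝ}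
    (hK : ∀ z, |K z| ≤ A / ((supNorm z : ℝ) + 1) ^ a) (hWinf : ∀ s ∈ box 4 ρ, |w s| ≤ Winf)
    {p : Pt} (hp : supNorm p ≤ 2 * ρ) :
    |∑ s ∈ box 4 ρ, w s * K (p - s)| ≤ Winf * A * ∑ t ∈ box 4 (3 * ρ), 1 / ((supNorm t : ℝ) + 1) ^ a := by
  have hA := letter_nonneg_of_le hK
  have hWi := flat_nonneg_of_le hWinf
  -- termwise
  have hterm : ∀ s ∈ box 4 ρ, |w s * K (p - s)| ≤ Winf * (A * (1 / ((supNorm (p - s) : ℝ) + 1) ^ a)) := by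
    intro s hs
    rw [abs_mul]
    refine mul_le_mul (hWinf s hs) ?_ (abs_nonneg _) hWi
    have h := hK (p - s)
    rwa [div_eq_mul_one_div] at h
  -- the translated box sits inside `box (3ρ)`
  have hinj : Set.InjOn (fun s : Pt => p - s) (box 4 ρ : Set Pt) := fun s _ t _ h => sub_right_injective h
  have hsub : (box 4 ρ).image (fun s => p - s) ⊆ box 4 (3 * ρ) := by
    intro t ht
    obtain ⟨s, hs, rfl⟩ := mem_image.mp ht
    rw [mem_box_iff] at hs ⊢
    have := supNorm_sub_le_nat p s
    omega
  have hreindex : ∑ s ∈ box 4 ρ, 1 / ((supNorm (p - s) : ℝ) + 1) ^ a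
      = ∑ t ∈ (box 4 ρ).image (fun s => p - s), 1 / ((supNorm t : ℝ) + 1) ^ a := by
    rw [sum_image (fun s hs t ht h => hinj hs ht h)]
  calc |∑ s ∈ box 4 ρ, w s * K (p - s)| ≤ ∑ s ∈ box 4 ρ, |w s * K (p - s)| := abs_sum_le_sum_abs _ _
    _ ≤ ∑ s ∈ box 4 ρ, Winf * (A * (1 / ((supNorm (p - s) : ℝ) + 1) ^ a)) := sum_le_sum hterm
    _ = Winf * A * ∑ s ∈ box 4 ρ, 1 / ((supNorm (p - s) : ℝ) + 1) ^ a := by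
        rw [← mul_sum, ← mul_sum, mul_assoc]
    _ ≤ Winf * A * ∑ t ∈ box 4 (3 * ρ), 1 / ((supNorm t : ℝ) + 1) ^ a := by
        rw [hreindex]
        exact mul_le_mul_of_nonneg_left
          (sum_le_sum_of_subset_of_nonneg hsub (fun _ _ _ => by positivity)) (mul_nonneg hWi hA)

/-- **NEAR FIELD.**  For `‖p‖∞ ≤ 2ρ` and `a ≤ 3`: `|Σ_{s ∈ box ρ} w s·K(p − s)| ≤ W∞·A·(81·(3ρ+1)^{4−a})`. [our bookkeeping] -/
theorem abs_blockSum_le_near {w K : Pt → ℝ} {ρ a : ℕ} {A Winf : ℝ} (ha : a ≤ 3)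
    (hK : ∀ z, |K z| ≤ A / ((supNorm z : ℝ) + 1) ^ a) (hWinf : ∀ s ∈ box 4 ρ, |w s| ≤ Winf)
    {p : Pt} (hp : supNorm p ≤ 2 * ρ) :
    |∑ s ∈ box 4 ρ, w s * K (p - s)| ≤ Winf * A * (81 * ((3 * ρ : ℕ) + 1 : ℝ) ^ (4 - a)) :=
  (abs_blockSum_le_near_sum hK hWinf hp).trans
    (mul_le_mul_of_nonneg_left (sum_box_inv_pow_succ_le ha (3 * ρ)) (mul_nonneg (flat_nonneg_of_le hWinf) (letter_nonneg_of_le hK)))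

/-! ## §4 FAR FIELD: the mass letter against the kernel at half the distance -/

/-- [our bookkeeping] In the far field `2ρ < ‖p‖∞`, every point of the translated box is at distance `≥ (‖p‖∞+1)∕2 − 1` in the sense
`(‖p‖∞ + 1) ≤ 2·(‖p − s‖∞ + 1)` for `‖s‖∞ ≤ ρ`. -/
theorem succ_le_two_mul_succ_of_far {p s : Pt} {ρ : ℕ} (hs : supNorm s ≤ ρ) (hp : 2 * ρ < supNorm p) :
    (supNorm p : ℝ) + 1 ≤ 2 * ((supNorm (p - s) : ℝ) + 1) := by
  have h := supNorm_le_supNorm_sub_add p s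
  have : supNorm p + 1 ≤ 2 * (supNorm (p - s) + 1) := by omega
  exact_mod_cast this

/-- [our bookkeeping] Hence the kernel letter at half the distance: `A∕(‖p − s‖∞+1)^a ≤ 2^a·A∕(‖p‖∞+1)^a`. -/
theorem letter_shift_far {p s : Pt} {ρ a : ℕ} {A : ℝ} (hA : 0 ≤ A) (hs : supNorm s ≤ ρ) (hp : 2 * ρ < supNorm p) :
    A / ((supNorm (p - s) : ℝ) + 1) ^ a ≤ 2 ^ a * A / ((supNorm p : ℝ) + 1) ^ a := by
  have h := succ_le_two_mul_succ_of_far hs hp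
  rw [div_le_div_iff₀ (by positivity) (by positivity), mul_comm ((2 : ℝ) ^ a) A, mul_assoc, ← mul_pow]
  exact mul_le_mul_of_nonneg_left (pow_le_pow_left₀ (by positivity) h a) hA

/-- **FAR FIELD.**  For `2ρ < ‖p‖∞`: `|Σ_{s ∈ box ρ} w s·K(p − s)| ≤ W₁·(2^a·A∕(‖p‖∞+1)^a)` — the mass letter times the kernel letter at half
the distance; valid for EVERY degree `a`. [our bookkeeping] -/
theorem abs_blockSum_le_far {w K : Pt → ℝ} {ρ a : ℕ} {A W₁ : ℝ}
    (hK : ∀ z, |K z| ≤ A / ((supNorm z : ℝ) + 1) ^ a) (hW1 : ∑ s ∈ box 4 ρ, |w s| ≤ W₁)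
    {p : Pt} (hp : 2 * ρ < supNorm p) :
    |∑ s ∈ box 4 ρ, w s * K (p - s)| ≤ W₁ * (2 ^ a * A / ((supNorm p : ℝ) + 1) ^ a) := by
  have hA := letter_nonneg_of_le hK
  have hB : 0 ≤ 2 ^ a * A / ((supNorm p : ℝ) + 1) ^ a := by positivity
  have hterm : ∀ s ∈ box 4 ρ, |w s * K (p - s)| ≤ |w s| * (2 ^ a * A / ((supNorm p : ℝ) + 1) ^ a) := by
    intro s hs
    rw [abs_mul]
    exact mul_le_mul_of_nonneg_left ((hK (p - s)).trans (letter_shift_far hA (mem_box_iff.mp hs) hp)) (abs_nonneg _)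
  calc |∑ s ∈ box 4 ρ, w s * K (p - s)| ≤ ∑ s ∈ box 4 ρ, |w s * K (p - s)| := abs_sum_le_sum_abs _ _
    _ ≤ ∑ s ∈ box 4 ρ, |w s| * (2 ^ a * A / ((supNorm p : ℝ) + 1) ^ a) := sum_le_sum hterm
    _ = (∑ s ∈ box 4 ρ, |w s|) * (2 ^ a * A / ((supNorm p : ℝ) + 1) ^ a) := by rw [sum_mul]
    _ ≤ W₁ * (2 ^ a * A / ((supNorm p : ℝ) + 1) ^ a) := mul_le_mul_of_nonneg_right hW1 hB

/-! ## §5 THE PROFILE: one bound for every position -/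

/-- [our bookkeeping] Near-field arithmetic: for `‖p‖∞ ≤ 2ρ` and `a ≤ 4`,
`(3ρ+1)^{4−a}·(ρ+1+‖p‖∞)^a ≤ 81·(ρ+1)⁴`. -/
theorem near_arith {ρ a : ℕ} (ha : a ≤ 4) {p : Pt} (hp : supNorm p ≤ 2 * ρ) :
    ((3 * ρ : ℕ) + 1 : ℝ) ^ (4 - a) * ((ρ : ℝ) + 1 + supNorm p) ^ a ≤ 81 * ((ρ : ℝ) + 1) ^ 4 := by
  have hp' : (supNorm p : ℝ) ≤ 2 * ρ := by exact_mod_cast hp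
  have h1 : ((3 * ρ : ℕ) + 1 : ℝ) ≤ 3 * ((ρ : ℝ) + 1) := by push_cast; linarith
  have h2 : (ρ : ℝ) + 1 + supNorm p ≤ 3 * ((ρ : ℝ) + 1) := by linarith
  calc ((3 * ρ : ℕ) + 1 : ℝ) ^ (4 - a) * ((ρ : ℝ) + 1 + supNorm p) ^ a
      ≤ (3 * ((ρ : ℝ) + 1)) ^ (4 - a) * (3 * ((ρ : ℝ) + 1)) ^ a := by
        gcongr
  _ = (3 * ((ρ : ℝ) + 1)) ^ 4 := by rw [← pow_add, Nat.sub_add_cancel ha]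
  _ = 81 * ((ρ : ℝ) + 1) ^ 4 := by ring

/-- [our bookkeeping] Far-field arithmetic: for `2ρ < ‖p‖∞`, `2^b∕(‖p‖∞+1)^b ≤ 3^b∕(ρ+1+‖p‖∞)^b` (since `2(ρ+1+‖p‖∞) ≤ 3(‖p‖∞+1)`). -/
theorem far_arith {ρ : ℕ} (b : ℕ) {p : Pt} (hp : 2 * ρ < supNorm p) :
    (2 : ℝ) ^ b / ((supNorm p : ℝ) + 1) ^ b ≤ 3 ^ b / ((ρ : ℝ) + 1 + supNorm p) ^ b := by
  have hp' : 2 * (ρ : ℝ) + 1 ≤ supNorm p := by exact_mod_cast hp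
  rw [div_le_div_iff₀ (by positivity) (by positivity), ← mul_pow, ← mul_pow]
  exact pow_le_pow_left₀ (by positivity) (by linarith) b

/-- **THE PROFILE.**  For `a ≤ 3` and EVERY position `p`:
`|Σ_{s ∈ box ρ} w s·K(p − s)| ≤ 3^a·(6561·W∞·(ρ+1)⁴ + W₁)·A ∕ (ρ + 1 + ‖p‖∞)^a`
— the kernel's own profile with its singularity smoothed at scale `ρ`, amplitude «flatness × volume + mass».  With a contour-block column
(`W₁ ≍ W∞(ρ+1)⁴ ≍ n`, `ρ ≍ n`, `a = 2`) this is the row's `C·n^{3−d}(1 + r∕n)^{2−d}`. [our bookkeeping] -/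
theorem abs_blockSum_le_profile {w K : Pt → ℝ} {ρ a : ℕ} {A W₁ Winf : ℝ} (ha : a ≤ 3)
    (hK : ∀ z, |K z| ≤ A / ((supNorm z : ℝ) + 1) ^ a)
    (hW1 : ∑ s ∈ box 4 ρ, |w s| ≤ W₁) (hWinf : ∀ s ∈ box 4 ρ, |w s| ≤ Winf) (p : Pt) :
    |∑ s ∈ box 4 ρ, w s * K (p - s)|
      ≤ 3 ^ a * (6561 * Winf * ((ρ : ℝ) + 1) ^ 4 + W₁) * A / ((ρ : ℝ) + 1 + supNorm p) ^ a := by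
  have hA := letter_nonneg_of_le hK
  have hWi := flat_nonneg_of_le hWinf
  have hW := mass_nonneg_of_le hW1
  have hD : (0 : ℝ) < ((ρ : ℝ) + 1 + supNorm p) ^ a := by positivity
  have h3a : (1 : ℝ) ≤ 3 ^ a := one_le_pow₀ (by norm_num)
  rcases le_or_gt (supNorm p) (2 * ρ) with hp | hp
  · -- near field
    refine (abs_blockSum_le_near ha hK hWinf hp).trans ?_
    rw [le_div_iff₀ hD]
    have hna := near_arith (by omega : a ≤ 4) hp
    calc Winf * A * (81 * ((3 * ρ : ℕ) + 1 : ℝ) ^ (4 - a)) * ((ρ : ℝ) + 1 + supNorm p) ^ a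
        = Winf * A * 81 * (((3 * ρ : ℕ) + 1 : ℝ) ^ (4 - a) * ((ρ : ℝ) + 1 + supNorm p) ^ a) := by ring
      _ ≤ Winf * A * 81 * (81 * ((ρ : ℝ) + 1) ^ 4) := mul_le_mul_of_nonneg_left hna (by positivity)
      _ = 1 * (6561 * Winf * ((ρ : ℝ) + 1) ^ 4) * A := by ring
      _ ≤ 3 ^ a * (6561 * Winf * ((ρ : ℝ) + 1) ^ 4 + W₁) * A := by
          apply mul_le_mul_of_nonneg_right _ hA
          have hX : 0 ≤ 6561 * Winf * ((ρ : ℝ) + 1) ^ 4 := by positivity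
          nlinarith
  · -- far field
    refine (abs_blockSum_le_far hK hW1 hp).trans ?_
    have hfa := far_arith a hp
    calc W₁ * (2 ^ a * A / ((supNorm p : ℝ) + 1) ^ a) = W₁ * A * (2 ^ a / ((supNorm p : ℝ) + 1) ^ a) := by ring
      _ ≤ W₁ * A * (3 ^ a / ((ρ : ℝ) + 1 + supNorm p) ^ a) := mul_le_mul_of_nonneg_left hfa (mul_nonneg hW hA)
      _ = 3 ^ a * W₁ * A / ((ρ : ℝ) + 1 + supNorm p) ^ a := by ring
      _ ≤ 3 ^ a * (6561 * Winf * ((ρ : ℝ) + 1) ^ 4 + W₁) * A / ((ρ : ℝ) + 1 + supNorm p) ^ a := by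
          gcongr
          · have : 0 ≤ 6561 * Winf * ((ρ : ℝ) + 1) ^ 4 := by positivity
            linarith

/-- **THE PROFILE FOR A PLAIN AVERAGE.**  If the weight is normalised like an average — mass `≤ 1` and flatness × volume `W∞·(ρ+1)⁴ ≤ 1` —
the amplitude is the pure number `3^a·6562·A`. [our bookkeeping] -/
theorem abs_blockSum_le_profile_avg {w K : Pt → ℝ} {ρ a : ℕ} {A Winf : ℝ} (ha : a ≤ 3)
    (hK : ∀ z, |K z| ≤ A / ((supNorm z : ℝ) + 1) ^ a)
    (hW1 : ∑ s ∈ box 4 ρ, |w s| ≤ 1) (hWinf : ∀ s ∈ box 4 ρ, |w s| ≤ Winf) (hvol : Winf * ((ρ : ℝ) + 1) ^ 4 ≤ 1) (p : Pt) :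
    |∑ s ∈ box 4 ρ, w s * K (p - s)| ≤ 3 ^ a * 6562 * A / ((ρ : ℝ) + 1 + supNorm p) ^ a := by
  have hA := letter_nonneg_of_le hK
  refine (abs_blockSum_le_profile ha hK hW1 hWinf p).trans ?_
  have hD : (0 : ℝ) < ((ρ : ℝ) + 1 + supNorm p) ^ a := by positivity
  rw [div_le_div_iff_of_pos_right hD]
  have : 6561 * Winf * ((ρ : ℝ) + 1) ^ 4 + 1 ≤ 6562 := by linarith
  calc 3 ^ a * (6561 * Winf * ((ρ : ℝ) + 1) ^ 4 + 1) * A ≤ 3 ^ a * 6562 * A := by gcongr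
    _ = 3 ^ a * 6562 * A := rfl

/-! ## §6 DIFFERENCES IN THE POSITION: the block sum of the difference kernel — one power better -/

/-- [our bookkeeping] Shifting the position commutes with the block sum: the `v`-difference of the block sum is the block sum of the
`v`-difference kernel `z ↦ K(z + v) − K z`. -/
theorem blockSum_shift_sub (w K : Pt → ℝ) (ρ : ℕ) (p v : Pt) :
    ∑ s ∈ box 4 ρ, w s * K (p + v - s) - ∑ s ∈ box 4 ρ, w s * K (p - s)
      = ∑ s ∈ box 4 ρ, w s * (K (p - s + v) - K (p - s)) := by
  rw [← sum_sub_distrib]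
  refine sum_congr rfl fun s _ => ?_
  rw [show p + v - s = p - s + v by abel]; ring

/-- **DIFFERENCES ARE ONE POWER BETTER.**  If the coordinate difference `Δ_i K` has the letter `A₁` at degree `a + 1 ≤ 3`, the `e_i`-difference
of the block sum in the position obeys the PROFILE at degree `a + 1`:
`|Σ_s w s·K(p + e_i − s) − Σ_s w s·K(p − s)| ≤ 3^{a+1}·(6561·W∞(ρ+1)⁴ + W₁)·A₁ ∕ (ρ+1+‖p‖∞)^{a+1}`. [our bookkeeping] -/
theorem abs_blockSum_fwdDiff_le_profile {w K : Pt → ℝ} {ρ a : ℕ} {A₁ W₁ Winf : ℝ} (ha : a + 1 ≤ 3) (i : Fin 4)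
    (hΔ : ∀ z, |K (z + Pi.single i 1) - K z| ≤ A₁ / ((supNorm z : ℝ) + 1) ^ (a + 1))
    (hW1 : ∑ s ∈ box 4 ρ, |w s| ≤ W₁) (hWinf : ∀ s ∈ box 4 ρ, |w s| ≤ Winf) (p : Pt) :
    |∑ s ∈ box 4 ρ, w s * K (p + Pi.single i 1 - s) - ∑ s ∈ box 4 ρ, w s * K (p - s)|
      ≤ 3 ^ (a + 1) * (6561 * Winf * ((ρ : ℝ) + 1) ^ 4 + W₁) * A₁ / ((ρ : ℝ) + 1 + supNorm p) ^ (a + 1) := by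
  rw [blockSum_shift_sub]
  exact abs_blockSum_le_profile (K := fun z => K (z + Pi.single i 1) - K z) ha hΔ hW1 hWinf p

end Summit.QuantumFields.BalabanUV.Beta.FP.BlockAveragedKernel

end
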